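import Mathlib.RepresentationTheory.Rep.Basic
import Mathlib.LinearAlgebra.FiniteDimensional.Basic
import Mathlib.Order.WellFounded

/-!
# Route LinearSystemTorelli — crux `LocalTubeSpan` (stmt-HodgeConjecture-2490): invariants are witnessed by finitely many group elements

Helper file (`--supports stmt-HodgeConjecture-2490`, line `Sketch` of the crux chain, cycle 4
"portability of cyclic detection", stub `stub_finiteWitness`).  The line reduces the crux (the
"local Schnell theorem") to CYCLIC DETECTION — injectivity of Schnell's third map
`H¹(G, V) → ∏_{g ∈ G} V/(g - 1)V` — and cycle 4 shows detection is PORTABLE along an extension of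
scalars `k → K` for FINITE-DIMENSIONAL representations of an ARBITRARY group `G`.  The ascent
(`stub_coordinatesUp`) decomposes an undetected `K`-cocycle along a `k`-basis of `K` into undetected
`k`-cocycles `φ_j = d x_j` and needs that only finitely many `φ_j` are non-zero; the finiteness it
consumes is NOT finite generation of `G` but the statement of this file:

* `localTubeSpan_exists_finset_fixed_imp_fixed` — for a finite-dimensional representation
  `A : Rep k G` over a field there is a finite set `F ⊆ G` such that every vector fixed by all
  `g ∈ F` is fixed by all of `G`; i.e. the invariants `V^G = ⋂_{g ∈ G} ker (ρ g - 1)` are already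
  cut out by finitely many group elements.

Proof: for a finite `F ⊆ G` let `W F = ⋂_{g ∈ F} ker (ρ g - 1)` (the vectors fixed by `F`,
`localTubeSpan_mem_iInf_ker_sub_id_iff`), a submodule of the finite-dimensional space `V`; choose
`F₀` minimising `dim W F` (`Function.argmin` on `ℕ`).  For any `g`, `W (insert g F₀) ≤ W F₀`
(`localTubeSpan_iInf_ker_sub_id_insert_le`) has dimension `≥ dim W F₀` by minimality, so the two
coincide (`Submodule.eq_of_le_of_finrank_le`) and every `F₀`-fixed vector is `g`-fixed.  Pure
linear algebra over Mathlib; no named facts.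
-/

-- `Summit.HodgeConjecture.HodgeConjecture.Theorems` is the mandated namespace (single-conjunct summit:
-- Sub = Summit), which `linter.dupNamespace` flags on every declaration; the lakefile turns the
-- linter off tree-wide (weak option), restated here so stand-alone elaboration is warning-free too.
set_option linter.dupNamespace false

noncomputable section

open CategoryTheory

namespace Summit.HodgeConjecture.HodgeConjecture.Theorems

universe u

section FiniteWitness

variable {k G : Type u} [Group G] [Field k]

/-- Membership in the `F`-fixed subspace `⋂_{g ∈ F} ker (ρ g - 1)` of a representation: `x` is
fixed by every `g ∈ F`. [folklore] -/
theorem localTubeSpan_mem_iInf_ker_sub_id_iff (A : Rep k G) (F : Finset G) (x : A.V) :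
    x ∈ (⨅ g ∈ F, LinearMap.ker (A.ρ g - LinearMap.id) : Submodule k A.V) ↔
      ∀ g ∈ F, A.ρ g x = x := by
  simp only [Submodule.mem_iInf, LinearMap.mem_ker, LinearMap.sub_apply, LinearMap.id_apply,
    sub_eq_zero]

/-- The `F`-fixed subspace `⋂_{g ∈ F} ker (ρ g - 1)` is antitone in `F`: adjoining a constraint
`g` cuts out a smaller submodule. [folklore] -/
theorem localTubeSpan_iInf_ker_sub_id_insert_le [DecidableEq G] (A : Rep k G) (F : Finset G)
    (g : G) :
    (⨅ h ∈ insert g F, LinearMap.ker (A.ρ h - LinearMap.id) : Submodule k A.V) ≤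
      ⨅ h ∈ F, LinearMap.ker (A.ρ h - LinearMap.id) := by
  intro x hx
  rw [localTubeSpan_mem_iInf_ker_sub_id_iff] at hx ⊢
  exact fun h hh => hx h (Finset.mem_insert_of_mem hh)

/-- **Invariants are witnessed by finitely many group elements.**  For a finite-dimensional
representation `A : Rep k G` of an arbitrary group `G` over a field `k` there is a finite set
`F ⊆ G` such that every vector fixed by all `g ∈ F` is fixed by all of `G`: the invariants
`V^G = ⋂_{g ∈ G} ker (ρ g - 1)` are attained by a finite sub-intersection (take `F` minimising
`dim ⋂_{g ∈ F} ker (ρ g - 1)`).  This — not finite generation of `G` — is the finiteness input of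
the ascent of cyclic detection along an extension of scalars. [folklore] -/
theorem localTubeSpan_exists_finset_fixed_imp_fixed (A : Rep k G) [FiniteDimensional k A.V] :
    ∃ F : Finset G, ∀ x : A.V, (∀ g ∈ F, A.ρ g x = x) → ∀ g : G, A.ρ g x = x := by
  classical
  -- `W F` = the `F`-fixed subspace; `d F` = its dimension, minimised over all finite `F` at `F₀`
  let W : Finset G → Submodule k A.V := fun F => ⨅ h ∈ F, LinearMap.ker (A.ρ h - LinearMap.id)
  let d : Finset G → ℕ := fun F => Module.finrank k (W F)
  let F₀ : Finset G := Function.argmin d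
  have hmin : ∀ F : Finset G, d F₀ ≤ d F := fun F => Function.argmin_le d F
  refine ⟨F₀, fun x hx g => ?_⟩
  -- minimality forces `W (insert g F₀) = W F₀`
  have heq : W (insert g F₀) = W F₀ :=
    Submodule.eq_of_le_of_finrank_le (localTubeSpan_iInf_ker_sub_id_insert_le A F₀ g)
      (hmin (insert g F₀))
  have hx₀ : x ∈ W F₀ := (localTubeSpan_mem_iInf_ker_sub_id_iff A F₀ x).2 hx
  rw [← heq] at hx₀
  exact (localTubeSpan_mem_iInf_ker_sub_id_iff A _ x).1 hx₀ g (Finset.mem_insert_self g F₀)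

end FiniteWitness

end Summit.HodgeConjecture.HodgeConjecture.Theorems

end
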